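import Summits.AnomalousDissipation.AnomalousDissipation.Theorems.SawtoothPulseCascadeK1LocalisedCascadeClassBlocks
import Summits.AnomalousDissipation.AnomalousDissipation.Theorems.SawtoothPulseCascadeK1LocalisedCascadeBlockKernel

/-!
# K1loc, line `Spectral` / thin start — helper: RATIO CLASSES THROUGH A HALF-STEP, SUMMED OVER FIBRE BLOCKS (V and H; concrete windows)

Helper file of the prover lane on the crux `K1LocalisedCascade` (stmt-AnomalousDissipation-19491), route `SawtoothPulseCascade`
(S-B/S-C assembly seat; the LEDGER ASSEMBLY, concrete class steps).  The multi-block forms of `…RatioClassStepV/H`: the window is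
built here (finite set, plateau `p_m(n) = ⌊v|n|/u⌋ + Q₂^m`), the per-fibre conditions of `…ClassBlocks` are discharged by
`…BlockKernel`, and what remains are PER-BLOCK SCALAR hypotheses — `Q₁^m < Q₂^m`, `uQ₂^m < Λ_m(uG − v)`, `8τ_m ≤ A_m d₀^m`,
`Mδ_j < πN_j d₀^m`, `A_m·2π(Λ_{m+1}G)e^{−M²/2}/(2N_j) ≤ ε₀^m` with `A_m = ((v+uG)Λ_m + uQ₂^m)/((uG−v)Λ_m − uQ₂^m)`,
`τ_m = uπ/((uG−v)Λ_m − uQ₂^m)` — and the FEED inclusion `u′Λ_{m+1} ≤ v′(Q₁^m + 1)`: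
* **`tsum_ratioClass_vstep_blocks_le`** (V; classes `O′`, `A` of `a_{j+1}`; feed = a shallow class `{Y ≤ |k₀| ∧ u′|k₁| ≤ v′|k₀|}` of `b_j`);
* **`tsum_ratioClass_hstep_blocks_le`** (H; classes `C = Bc`, `B` of `b_j`; feed = a class `{Y ≤ |k₀| ∧ u′|k₀| ≤ v′|k₁|}` of `a_j`).
Output shape `(√(Σ_{m<M} J_m²) + √feed)² + far`, consumed by `…LedgerClassChain` / `…LedgerClassEnergyChain` / `K1Window.LedgerChain`.
No definitions; no statement about the crux. [cite: Grafakos2014, Prop. 3.1.2 (5), Prop. 3.2.7 (3), §3.1.3]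
[cite: ElgindiLissMattingly2025, §1 (slope ±1 branches)] [problem: turb]
-/

-- `Summit.<Summit>.<Problem>`: single-conjunct summit, the duplicate namespace segment is deliberate.
set_option linter.dupNamespace false

noncomputable section

namespace Summit.AnomalousDissipation.AnomalousDissipation.Theorems.SawtoothPulseCascade.K1Window

open MeasureTheory Set Filter Topology UnitAddTorus Function Complex Metric
open scoped Real ENNReal
open Literature.Analysis Literature.Analysis.FunctionSpaces Literature.Analysis.FunctionSpaces.Torus Literature.Analysis.FluidPDE
open Literature.Analysis.FluidPDE.ShearStage
open Literature.Analysis.FluidPDE.SawtoothCascade Literature.Analysis.FluidPDE.SawtoothCascade.CascadeParams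
open Summit.AnomalousDissipation.AnomalousDissipation.Theorems.SawtoothPulseCascade.K1Start
open Summit.AnomalousDissipation.AnomalousDissipation.Theorems.SawtoothPulseCascade.K1Flat
open Summit.AnomalousDissipation.AnomalousDissipation.Theorems.SawtoothPulseCascade.K1Ledger.From

section Cascade

variable (P : CascadeParams)

/-! ## §1 V half-step: ratio classes of `a_{j+1}` (fibres `k₁`) -/

/-- **A RATIO CLASS OF `a_{j+1}` THROUGH THE V HALF-STEP, SUMMED OVER FIBRE BLOCKS** (the multi-block form of
`…RatioClassStepV.tsum_ratioClass_vstep_le`; serves (O-V) and (A-V) of the class ledger).  Class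
`Σ'[X ≤ |k₀| ∧ u|k₀| ≤ v|k₁|]‖𝓕a_{j+1}‖²` (`0 < u`, `0 < v < uG`); fibre blocks `[Λ_m, Λ_{m+1})`, `m < M`, in `k₁`
(`Λ` monotone, `vΛ₀ ≤ uX`, `Λ₀ ≥ 1`); on block `m` the cut-offs `Q₁^m < Q₂^m` with `uQ₂^m < Λ_m(uG − v)` (plateau
`⌊v|k₁|/u⌋ + Q₂^m` below the chirp shift), kernel data `d₀^m, ε₀^m` with `8τ_m ≤ A_m d₀^m`, `Mδ_j < πN_j d₀^m`,
`A_m·2π(Λ_{m+1}G)e^{−M²/2}/(2N_j) ≤ ε₀^m`, where `A_m = ((v+uG)Λ_m + uQ₂^m)/((uG−v)Λ_m − uQ₂^m)`,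
`τ_m = uπ/((uG−v)Λ_m − uQ₂^m)`; FEED = the shallow class `Σ'[Y ≤ |k₀| ∧ u′|k₁| ≤ v′|k₀|]‖𝓕b_j‖²` whenever
`u′Λ_{m+1} ≤ v′(Q₁^m + 1)` and `Y ≤ Q₁^m + 1` for all `m`.  Then
`class ≤ (√(Σ_{m<M} J_m²) + √feed)² + ((1+γ)^{2(j+1)}/Λ_M)²`, `J_m = ((Q₁^m+Q₂^m)/(Q₂^m−Q₁^m))(ε₀^m + A_m√(2N_j·4d₀^m))`.
[cite: Grafakos2014, Prop. 3.1.2 (5), Prop. 3.2.7 (3), §3.1.3] -/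
theorem tsum_ratioClass_vstep_blocks_le {G : ℕ} (hγ : P.γ = G) (hδ₀ : 0 < P.δ₀) (hd : 0 < P.d) (hN₀ : 1 ≤ P.N₀)
    (hρN : 1 ≤ P.ρN) (a b : ℕ → UnitAddTorus (Fin 2) → ℝ) (has : ∀ j, IsSmooth (a j)) (h0 : a 0 = datum)
    (hb : ∀ j, b j = a j ∘ shearMap 0 1 (amp ⟨P.U j, P.U_periodic j, P.contDiff_U (P.δ_pos hδ₀ hd j)⟩ P.γ))
    (hab : ∀ j, a (j + 1) = b j ∘ shearMap 1 0 (amp ⟨P.U j, P.U_periodic j, P.contDiff_U (P.δ_pos hδ₀ hd j)⟩ P.γ))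
    (j : ℕ) {u v X : ℕ} (hu : 0 < u) (hv : 0 < v) (hvu : v < u * G)
    (Λb : ℕ → ℕ) (hΛb : Monotone Λb) (hΛ0 : 1 ≤ Λb 0) (Mb : ℕ) (hΛX : v * Λb 0 ≤ u * X)
    (Q₁ Q₂ : ℕ → ℕ) (hQ : ∀ m, Q₁ m < Q₂ m) (hΛQ : ∀ m, u * Q₂ m < Λb m * (u * G - v))
    {M : ℝ} (hM : 1 ≤ M) (hMδ : M * P.δ j < π / 2)
    (d₀ ε₀ : ℕ → ℝ) (hd₀ : ∀ m, 0 < d₀ m) (hMd : ∀ m, M * P.δ j < π * P.N j * d₀ m)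
    (hAd : ∀ m, 8 * ((u : ℝ) * π / (((u : ℝ) * G - v) * Λb m - u * Q₂ m)) ≤
      (((v : ℝ) + u * G) * Λb m + u * Q₂ m) / (((u : ℝ) * G - v) * Λb m - u * Q₂ m) * d₀ m)
    (hε0 : ∀ m, 0 ≤ ε₀ m)
    (hε : ∀ m, (((v : ℝ) + u * G) * Λb m + u * Q₂ m) / (((u : ℝ) * G - v) * Λb m - u * Q₂ m) *
      (2 * π * ((Λb (m + 1) * G : ℕ) : ℝ) * (Real.exp (-(M ^ 2 / 2)) / (2 * P.N j))) ≤ ε₀ m)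
    {u' v' Y : ℕ} (hfeed : ∀ m, u' * Λb (m + 1) ≤ v' * (Q₁ m + 1)) (hY : ∀ m, Y ≤ Q₁ m + 1) :
    ∑' k : Fin 2 → ℤ, (if (X : ℤ) ≤ |k 0| ∧ (u : ℤ) * |k 0| ≤ (v : ℤ) * |k 1| then (1 : ℝ) else 0) *
        ‖mFourierCoeff (fun x => (a (j + 1) x : ℂ)) k‖ ^ 2 ≤
      (Real.sqrt (∑ m ∈ Finset.range Mb, ((((Q₁ m : ℝ) + Q₂ m) / ((Q₂ m : ℝ) - Q₁ m)) *
            (ε₀ m + (((v : ℝ) + u * G) * Λb m + u * Q₂ m) / (((u : ℝ) * G - v) * Λb m - u * Q₂ m) *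
              Real.sqrt ((2 * P.N j : ℕ) * (4 * d₀ m)))) ^ 2) +
          Real.sqrt (∑' k : Fin 2 → ℤ, (if (Y : ℤ) ≤ |k 0| ∧ (u' : ℤ) * |k 1| ≤ (v' : ℤ) * |k 0| then (1 : ℝ) else 0) *
            ‖mFourierCoeff (fun x => (b j x : ℂ)) k‖ ^ 2)) ^ 2 +
        ((1 + P.γ) ^ (2 * (j + 1)) / Λb Mb) ^ 2 := by
  classical
  -- positivity of the block denominators
  have hc2 : (0 : ℝ) < (u : ℝ) * G - v := by
    have : (v : ℝ) < (u : ℝ) * G := by exact_mod_cast hvu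
    linarith
  have hΛr : ∀ m, (u : ℝ) * Q₂ m < ((u : ℝ) * G - v) * Λb m := fun m => by
    have h1 : ((u * Q₂ m : ℕ) : ℝ) < ((Λb m * (u * G - v) : ℕ) : ℝ) := by exact_mod_cast hΛQ m
    rw [Nat.cast_mul, Nat.cast_mul, Nat.cast_sub hvu.le, Nat.cast_mul] at h1
    linarith
  -- the plateau and the window
  set p : ℕ → ℤ → ℕ := fun m n => v * n.natAbs / u + Q₂ m with hp
  set W : Finset (Fin 2 → ℤ) :=
    ((Finset.Icc (-((v * Λb Mb : ℕ) : ℤ)) (v * Λb Mb : ℕ) ×ˢ Finset.Icc (-(Λb Mb : ℤ)) (Λb Mb)).filter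
      (fun q : ℤ × ℤ => (X : ℤ) ≤ |q.1| ∧ (u : ℤ) * |q.1| ≤ v * |q.2| ∧ (Λb 0 : ℤ) ≤ |q.2| ∧ |q.2| < (Λb Mb : ℤ))).image
      (fun q : ℤ × ℤ => (fun i : Fin 2 => if i = 0 then q.1 else q.2)) with hWdef
  have hWall : ∀ k ∈ W, (X : ℤ) ≤ |k 0| ∧ (u : ℤ) * |k 0| ≤ v * |k 1| ∧ (Λb 0 : ℤ) ≤ |k 1| ∧ |k 1| < (Λb Mb : ℤ) := by
    intro k hk
    obtain ⟨q, hq, rfl⟩ := Finset.mem_image.mp hk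
    have h := (Finset.mem_filter.mp hq).2
    simpa using h
  have hvz : (0 : ℤ) < v := by exact_mod_cast hv
  have hqW : ∀ k : Fin 2 → ℤ, ((X : ℤ) ≤ |k 0| ∧ (u : ℤ) * |k 0| ≤ (v : ℤ) * |k 1|) → |k 1| < (Λb Mb : ℤ) → k ∈ W := by
    intro k hk h2
    have hk1 : (Λb 0 : ℤ) ≤ |k 1| := by
      have hΛXz : (v : ℤ) * Λb 0 ≤ u * X := by exact_mod_cast hΛX
      have huz : (0 : ℤ) ≤ u := by positivity
      nlinarith [hk.1, hk.2, mul_le_mul_of_nonneg_left hk.1 huz]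
    have hk0 : |k 0| ≤ ((v * Λb Mb : ℕ) : ℤ) := by
      push_cast
      have h3 : (v : ℤ) * |k 1| ≤ v * Λb Mb := mul_le_mul_of_nonneg_left h2.le hvz.le
      have huz : (1 : ℤ) ≤ u := by exact_mod_cast hu
      nlinarith [abs_nonneg (k 0), hk.2]
    refine Finset.mem_image.mpr ⟨(k 0, k 1), ?_, ?_⟩
    · refine Finset.mem_filter.mpr ⟨Finset.mem_product.mpr ⟨Finset.mem_Icc.mpr ?_, Finset.mem_Icc.mpr ?_⟩,
        hk.1, hk.2, hk1, h2⟩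
      · exact ⟨by linarith [neg_abs_le (k 0)], by linarith [le_abs_self (k 0)]⟩
      · exact ⟨by linarith [neg_abs_le (k 1), h2.le], by linarith [le_abs_self (k 1), h2.le]⟩
    · funext i; fin_cases i <;> simp
  have hW : ∀ k ∈ W, (Λb 0 : ℤ) ≤ |k 1| ∧ |k 1| < (Λb Mb : ℤ) := fun k hk =>
    ⟨(hWall k hk).2.2.1, (hWall k hk).2.2.2⟩
  have hpG : ∀ m, ∀ k ∈ W, (Λb m : ℤ) ≤ |k 1| → |k 1| < (Λb (m + 1) : ℤ) → p m (k 1) < (k 1).natAbs * G :=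
    fun m k _ h1 _ => ratioPlateau_lt_shift hvu (hΛQ m) h1
  have hWp : ∀ m, ∀ k ∈ W, (Λb m : ℤ) ≤ |k 1| → |k 1| < (Λb (m + 1) : ℤ) → |k 0| + Q₂ m ≤ (p m (k 1) : ℤ) :=
    fun m k hk _ _ => ratioPlateau_window (Q₂ m) hu (hWall k hk).2.1
  set A : ℕ → ℝ := fun m => (((v : ℝ) + u * G) * Λb m + u * Q₂ m) / (((u : ℝ) * G - v) * Λb m - u * Q₂ m) with hA
  set τ : ℕ → ℝ := fun m => (u : ℝ) * π / (((u : ℝ) * G - v) * Λb m - u * Q₂ m) with hτ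
  have hA0 : ∀ m, 0 ≤ A m := fun m => div_nonneg (by positivity) (by linarith [hΛr m])
  have hA' : ∀ m, ∀ k ∈ W, (Λb m : ℤ) ≤ |k 1| → |k 1| < (Λb (m + 1) : ℤ) →
      ((p m (k 1) : ℝ) + ((k 1).natAbs * G : ℕ)) / ((((k 1).natAbs * G : ℕ) : ℝ) - p m (k 1)) ≤ A m :=
    fun m k _ h1 _ => ratioKernel_ratio_le hu hvu (hΛQ m) h1
  have hτ' : ∀ m, ∀ k ∈ W, (Λb m : ℤ) ≤ |k 1| → |k 1| < (Λb (m + 1) : ℤ) →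
      π / ((((k 1).natAbs * G : ℕ) : ℝ) - p m (k 1)) ≤ τ m :=
    fun m k _ h1 _ => ratioKernel_tau_le hu hvu (hΛQ m) h1
  have hPf : ∀ m, ∀ k : Fin 2 → ℤ, (Λb m : ℤ) ≤ |k 1| → |k 1| < (Λb (m + 1) : ℤ) → (Q₁ m : ℤ) < |k 0| →
      ((Y : ℤ) ≤ |k 0| ∧ (u' : ℤ) * |k 1| ≤ (v' : ℤ) * |k 0|) := by
    intro m k _ h2 h3
    have hf : ((u' * Λb (m + 1) : ℕ) : ℤ) ≤ ((v' * (Q₁ m + 1) : ℕ) : ℤ) := by exact_mod_cast hfeed m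
    have hYm : ((Y : ℕ) : ℤ) ≤ ((Q₁ m + 1 : ℕ) : ℤ) := by exact_mod_cast hY m
    push_cast at hf hYm
    have h3' : (Q₁ m : ℤ) + 1 ≤ |k 0| := h3
    refine ⟨by linarith, ?_⟩
    have hu'0 : (0 : ℤ) ≤ u' := by positivity
    have hv'0 : (0 : ℤ) ≤ v' := by positivity
    nlinarith [mul_le_mul_of_nonneg_left h2.le hu'0, mul_le_mul_of_nonneg_left h3' hv'0]
  exact tsum_class_vstep_blocks_le' P hγ hδ₀ hd hN₀ hρN a b has h0 hb hab j p _ Λb hΛb hΛ0 Mb W hqW hW hpG Q₁ Q₂ hQ hWp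
    hM hMδ d₀ A τ ε₀ hd₀ hMd hA0 hA' hτ' hAd hε0 hε _ hPf


/-! ## §2 H half-step: ratio classes of `b_j` (fibres `k₀`) -/

/-- **A RATIO CLASS OF `b_j` THROUGH THE H HALF-STEP, SUMMED OVER FIBRE BLOCKS** (the multi-block form of
`…RatioClassStepH.tsum_ratioClass_hstep_le`; serves (C-H) and (B-H) of the class ledger).  Class
`Σ'[Λ₀ ≤ |k₀| ∧ u|k₁| ≤ v|k₀|]‖𝓕b_j‖²` (`0 < u`, `0 < v < uG`); fibre blocks `[Λ_m, Λ_{m+1})`, `m < M`, in `k₀`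
(`Λ` monotone, `Λ₀ ≥ 1`; the class threshold IS the lowest fibre); on block `m` the cut-offs `Q₁^m < Q₂^m` with `uQ₂^m < Λ_m(uG − v)` (plateau
`⌊v|k₀|/u⌋ + Q₂^m` below the chirp shift), kernel data `d₀^m, ε₀^m` with `8τ_m ≤ A_m d₀^m`, `Mδ_j < πN_j d₀^m`,
`A_m·2π(Λ_{m+1}G)e^{−M²/2}/(2N_j) ≤ ε₀^m`, where `A_m = ((v+uG)Λ_m + uQ₂^m)/((uG−v)Λ_m − uQ₂^m)`,
`τ_m = uπ/((uG−v)Λ_m − uQ₂^m)`; FEED = the class `Σ'[Y ≤ |k₀| ∧ u′|k₀| ≤ v′|k₁|]‖𝓕a_j‖²` of `a_j` (shell / off-cone type) whenever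
`u′Λ_{m+1} ≤ v′(Q₁^m + 1)` for all `m` and `Y ≤ Λ₀`.  Then
`class ≤ (√(Σ_{m<M} J_m²) + √feed)² + ((1+γ)^{2j}/Λ_M)²`, `J_m = ((Q₁^m+Q₂^m)/(Q₂^m−Q₁^m))(ε₀^m + A_m√(2N_j·4d₀^m))`.
[cite: Grafakos2014, Prop. 3.1.2 (5), Prop. 3.2.7 (3), §3.1.3] -/
theorem tsum_ratioClass_hstep_blocks_le {G : ℕ} (hγ : P.γ = G) (hδ₀ : 0 < P.δ₀) (hd : 0 < P.d) (hN₀ : 1 ≤ P.N₀)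
    (hρN : 1 ≤ P.ρN) (a b : ℕ → UnitAddTorus (Fin 2) → ℝ) (has : ∀ j, IsSmooth (a j)) (h0 : a 0 = datum)
    (hb : ∀ j, b j = a j ∘ shearMap 0 1 (amp ⟨P.U j, P.U_periodic j, P.contDiff_U (P.δ_pos hδ₀ hd j)⟩ P.γ))
    (hab : ∀ j, a (j + 1) = b j ∘ shearMap 1 0 (amp ⟨P.U j, P.U_periodic j, P.contDiff_U (P.δ_pos hδ₀ hd j)⟩ P.γ))
    (j : ℕ) {u v : ℕ} (hu : 0 < u) (hv : 0 < v) (hvu : v < u * G)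
    (Λb : ℕ → ℕ) (hΛb : Monotone Λb) (hΛ0 : 1 ≤ Λb 0) (Mb : ℕ)
    (Q₁ Q₂ : ℕ → ℕ) (hQ : ∀ m, Q₁ m < Q₂ m) (hΛQ : ∀ m, u * Q₂ m < Λb m * (u * G - v))
    {M : ℝ} (hM : 1 ≤ M) (hMδ : M * P.δ j < π / 2)
    (d₀ ε₀ : ℕ → ℝ) (hd₀ : ∀ m, 0 < d₀ m) (hMd : ∀ m, M * P.δ j < π * P.N j * d₀ m)
    (hAd : ∀ m, 8 * ((u : ℝ) * π / (((u : ℝ) * G - v) * Λb m - u * Q₂ m)) ≤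
      (((v : ℝ) + u * G) * Λb m + u * Q₂ m) / (((u : ℝ) * G - v) * Λb m - u * Q₂ m) * d₀ m)
    (hε0 : ∀ m, 0 ≤ ε₀ m)
    (hε : ∀ m, (((v : ℝ) + u * G) * Λb m + u * Q₂ m) / (((u : ℝ) * G - v) * Λb m - u * Q₂ m) *
      (2 * π * ((Λb (m + 1) * G : ℕ) : ℝ) * (Real.exp (-(M ^ 2 / 2)) / (2 * P.N j))) ≤ ε₀ m)
    {u' v' Y : ℕ} (hfeed : ∀ m, u' * Λb (m + 1) ≤ v' * (Q₁ m + 1)) (hY : Y ≤ Λb 0) :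
    ∑' k : Fin 2 → ℤ, (if (Λb 0 : ℤ) ≤ |k 0| ∧ (u : ℤ) * |k 1| ≤ (v : ℤ) * |k 0| then (1 : ℝ) else 0) *
        ‖mFourierCoeff (fun x => (b j x : ℂ)) k‖ ^ 2 ≤
      (Real.sqrt (∑ m ∈ Finset.range Mb, ((((Q₁ m : ℝ) + Q₂ m) / ((Q₂ m : ℝ) - Q₁ m)) *
            (ε₀ m + (((v : ℝ) + u * G) * Λb m + u * Q₂ m) / (((u : ℝ) * G - v) * Λb m - u * Q₂ m) *
              Real.sqrt ((2 * P.N j : ℕ) * (4 * d₀ m)))) ^ 2) +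
          Real.sqrt (∑' k : Fin 2 → ℤ, (if (Y : ℤ) ≤ |k 0| ∧ (u' : ℤ) * |k 0| ≤ (v' : ℤ) * |k 1| then (1 : ℝ) else 0) *
            ‖mFourierCoeff (fun x => (a j x : ℂ)) k‖ ^ 2)) ^ 2 +
        ((1 + P.γ) ^ (2 * j) / Λb Mb) ^ 2 := by
  classical
  -- positivity of the block denominators
  have hc2 : (0 : ℝ) < (u : ℝ) * G - v := by
    have : (v : ℝ) < (u : ℝ) * G := by exact_mod_cast hvu
    linarith
  have hΛr : ∀ m, (u : ℝ) * Q₂ m < ((u : ℝ) * G - v) * Λb m := fun m => by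
    have h1 : ((u * Q₂ m : ℕ) : ℝ) < ((Λb m * (u * G - v) : ℕ) : ℝ) := by exact_mod_cast hΛQ m
    rw [Nat.cast_mul, Nat.cast_mul, Nat.cast_sub hvu.le, Nat.cast_mul] at h1
    linarith
  -- the plateau and the window
  set p : ℕ → ℤ → ℕ := fun m n => v * n.natAbs / u + Q₂ m with hp
  set W : Finset (Fin 2 → ℤ) :=
    ((Finset.Icc (-(Λb Mb : ℤ)) (Λb Mb) ×ˢ Finset.Icc (-((v * Λb Mb : ℕ) : ℤ)) (v * Λb Mb : ℕ)).filter
      (fun q : ℤ × ℤ => (Λb 0 : ℤ) ≤ |q.1| ∧ (u : ℤ) * |q.2| ≤ v * |q.1| ∧ |q.1| < (Λb Mb : ℤ))).image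
      (fun q : ℤ × ℤ => (fun i : Fin 2 => if i = 0 then q.1 else q.2)) with hWdef
  have hWall : ∀ k ∈ W, (Λb 0 : ℤ) ≤ |k 0| ∧ (u : ℤ) * |k 1| ≤ v * |k 0| ∧ |k 0| < (Λb Mb : ℤ) := by
    intro k hk
    obtain ⟨q, hq, rfl⟩ := Finset.mem_image.mp hk
    have h := (Finset.mem_filter.mp hq).2
    simpa using h
  have hvz : (0 : ℤ) < v := by exact_mod_cast hv
  have hqW : ∀ k : Fin 2 → ℤ, ((Λb 0 : ℤ) ≤ |k 0| ∧ (u : ℤ) * |k 1| ≤ (v : ℤ) * |k 0|) → |k 0| < (Λb Mb : ℤ) → k ∈ W := by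
    intro k hk h2
    have hk1 : |k 1| ≤ ((v * Λb Mb : ℕ) : ℤ) := by
      push_cast
      have h3 : (v : ℤ) * |k 0| ≤ v * Λb Mb := mul_le_mul_of_nonneg_left h2.le hvz.le
      have huz : (1 : ℤ) ≤ u := by exact_mod_cast hu
      nlinarith [abs_nonneg (k 1), hk.2]
    refine Finset.mem_image.mpr ⟨(k 0, k 1), ?_, ?_⟩
    · refine Finset.mem_filter.mpr ⟨Finset.mem_product.mpr ⟨Finset.mem_Icc.mpr ?_, Finset.mem_Icc.mpr ?_⟩,
        hk.1, hk.2, h2⟩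
      · exact ⟨by linarith [neg_abs_le (k 0), h2.le], by linarith [le_abs_self (k 0), h2.le]⟩
      · exact ⟨by linarith [neg_abs_le (k 1)], by linarith [le_abs_self (k 1)]⟩
    · funext i; fin_cases i <;> simp
  have hW : ∀ k ∈ W, (Λb 0 : ℤ) ≤ |k 0| ∧ |k 0| < (Λb Mb : ℤ) := fun k hk =>
    ⟨(hWall k hk).1, (hWall k hk).2.2⟩
  have hpG : ∀ m, ∀ k ∈ W, (Λb m : ℤ) ≤ |k 0| → |k 0| < (Λb (m + 1) : ℤ) → p m (k 0) < (k 0).natAbs * G :=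
    fun m k _ h1 _ => ratioPlateau_lt_shift hvu (hΛQ m) h1
  have hWp : ∀ m, ∀ k ∈ W, (Λb m : ℤ) ≤ |k 0| → |k 0| < (Λb (m + 1) : ℤ) → |k 1| + Q₂ m ≤ (p m (k 0) : ℤ) :=
    fun m k hk _ _ => ratioPlateau_window (Q₂ m) hu (hWall k hk).2.1
  set A : ℕ → ℝ := fun m => (((v : ℝ) + u * G) * Λb m + u * Q₂ m) / (((u : ℝ) * G - v) * Λb m - u * Q₂ m) with hA
  set τ : ℕ → ℝ := fun m => (u : ℝ) * π / (((u : ℝ) * G - v) * Λb m - u * Q₂ m) with hτ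
  have hA0 : ∀ m, 0 ≤ A m := fun m => div_nonneg (by positivity) (by linarith [hΛr m])
  have hA' : ∀ m, ∀ k ∈ W, (Λb m : ℤ) ≤ |k 0| → |k 0| < (Λb (m + 1) : ℤ) →
      ((p m (k 0) : ℝ) + ((k 0).natAbs * G : ℕ)) / ((((k 0).natAbs * G : ℕ) : ℝ) - p m (k 0)) ≤ A m :=
    fun m k _ h1 _ => ratioKernel_ratio_le hu hvu (hΛQ m) h1
  have hτ' : ∀ m, ∀ k ∈ W, (Λb m : ℤ) ≤ |k 0| → |k 0| < (Λb (m + 1) : ℤ) →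
      π / ((((k 0).natAbs * G : ℕ) : ℝ) - p m (k 0)) ≤ τ m :=
    fun m k _ h1 _ => ratioKernel_tau_le hu hvu (hΛQ m) h1
  have hPf : ∀ m, ∀ k : Fin 2 → ℤ, (Λb m : ℤ) ≤ |k 0| → |k 0| < (Λb (m + 1) : ℤ) → (Q₁ m : ℤ) < |k 1| →
      ((Y : ℤ) ≤ |k 0| ∧ (u' : ℤ) * |k 0| ≤ (v' : ℤ) * |k 1|) := by
    intro m k h1 h2 h3
    have hf : ((u' * Λb (m + 1) : ℕ) : ℤ) ≤ ((v' * (Q₁ m + 1) : ℕ) : ℤ) := by exact_mod_cast hfeed m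
    have hY' : ((Y : ℕ) : ℤ) ≤ ((Λb 0 : ℕ) : ℤ) := by exact_mod_cast hY
    have hm0 : ((Λb 0 : ℕ) : ℤ) ≤ ((Λb m : ℕ) : ℤ) := by exact_mod_cast hΛb (Nat.zero_le m)
    push_cast at hf
    have h3' : (Q₁ m : ℤ) + 1 ≤ |k 1| := h3
    refine ⟨by linarith, ?_⟩
    have hu'0 : (0 : ℤ) ≤ u' := by positivity
    have hv'0 : (0 : ℤ) ≤ v' := by positivity
    nlinarith [mul_le_mul_of_nonneg_left h2.le hu'0, mul_le_mul_of_nonneg_left h3' hv'0]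
  exact tsum_class_hstep_blocks_le P hγ hδ₀ hd hN₀ hρN a b has h0 hb hab j p _ Λb hΛb hΛ0 Mb W hqW hW hpG Q₁ Q₂ hQ hWp
    hM hMδ d₀ A τ ε₀ hd₀ hMd hA0 hA' hτ' hAd hε0 hε _ hPf

end Cascade

end Summit.AnomalousDissipation.AnomalousDissipation.Theorems.SawtoothPulseCascade.K1Window
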